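import Summits.AtomisticToContinuum.HydrodynamicLimit.Theorems.AntiMazurCoboundariesKineticFluxLdDecayHTheoremObjects
import Summits.AtomisticToContinuum.HydrodynamicLimit.Theorems.OneFlightGossipEngineKineticCurrentsWindowLDUniformOneBodyLedgerPrelimA
import HarnessLib

/-!
# The reduced one-body law and the gain identity for the crux line `h-theorem-dissipation-budget`
# (crux `KineticFluxLdDecay`, stmt-AtomisticToContinuum-10967) — registered stub `stub_oneBodyMarginal` (S2)

In the frame of `Theorems/AntiMazurCoboundariesKineticFluxLdDecayHTheoremObjects.lean` (statement
`HTheorem.OneBodyMarginal`): for the crux's flows `Φ` of `N + 1` hard spheres on `𝕋³`, `θ > 0`, and a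
probability law `ν ≪ G_N` (the flow-invariant homogeneous Gibbs law), the reduced one-body law
`f_t = (N+1)⁻¹ Σᵢ Law_ν (xᵢ(t), wᵢ(t))` (`HTheorem.oneBodyLaw`, reduced velocity `w = (v − u₀)/√θ`) is,
for every time `t`,

* a probability law (`HTheorem.isProbabilityMeasure_oneBodyLaw`);
* absolutely continuous w.r.t. `m = vol ⊗ γ` (`HTheorem.refMeasure`): `ν ≪ G_N`, `G_N` is `Φ_t`-invariant
  (`Theorems.measurePreserving_flow_localGibbsLaw_const`) and `G_N ≪ Lebesgue` (`localGibbsLaw_eq`: the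
  Gibbs law is a `withDensity` of Lebesgue measure on phase space); the `i`-th one-particle coordinate
  map quasi-preserves Lebesgue measure (`Measure.pi_eval_preimage_null`), and the one-body reduction
  `(x, v) ↦ (x, (v − u₀)/√θ)` pushes `vol ⊗ dv ≪ vol ⊗ N(u₀, θ id)` (tree:
  `KineticCurrentsWindowLDUniformLocalGibbs.obl_volume_absolutelyContinuous_gaussMeasure`) forward to a
  measure `≪ vol ⊗ γ` (`gaussMeasure u₀ θ` is the image of `γ` under `w ↦ u₀ + √θ w`, so its image under
  the reduction is `γ` itself): `quasiMeasurePreserving_oneBodyReduce`, `gibbs_preimage_reducedCoord_null`;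
* the carrier of the GAIN IDENTITY `E_ν[F∘Φ_t] = (N+1) ∫ φ(x) g(w) df_t(x, w)` for bounded measurable
  `φ, g` (change of variables `MeasureTheory.integral_map` particle by particle, then
  `integral_finsetSum`, `integral_finsetSum_measure`, `integral_smul_measure`).

Reference: H. Spohn, *Large Scale Dynamics of Interacting Particles* (1991), Part I §2.3 (one-particle
marginals of equilibrium measures).
-/

noncomputable section

open MeasureTheory ProbabilityTheory Set Filter
open scoped ENNReal

namespace Summit.AtomisticToContinuum.HydrodynamicLimit.Theorems.HTheorem

open Literature.MathematicalPhysics.KineticTheory (T3 V3 hsDiameter localGibbsLaw localGibbsLaw_eq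
  gaussMeasure measurable_gaussShift)
open Literature.Analysis.FluidPDE (HardSphereFlow Config)

/-! ### The one-body reduction `(x, v) ↦ (x, (v − u₀)/√θ)` -/

/-- The one-body reduction `(x, v) ↦ (x, (v − u₀)/√θ)` is measurable. -/
theorem measurable_oneBodyReduce (θ : ℝ) (u₀ : V3) :
    Measurable fun y : T3 × V3 => (y.1, (Real.sqrt θ)⁻¹ • (y.2 - u₀)) :=
  measurable_fst.prodMk ((measurable_const_smul _).comp (measurable_snd.sub_const u₀))

/-- The reduced coordinates of particle `i` are the one-body reduction of its coordinates. -/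
theorem reducedCoord_eq_comp (θ : ℝ) (u₀ : V3) (n : ℕ) (i : Fin n) :
    reducedCoord θ u₀ n i =
      (fun y : T3 × V3 => (y.1, (Real.sqrt θ)⁻¹ • (y.2 - u₀))) ∘ fun z : TPhase n => z i :=
  rfl

/-- Under `N(u₀, θ id)` the reduced velocity `(v − u₀)/√θ` is standard Gaussian (`θ > 0`): the image of
`gaussMeasure u₀ θ = γ ∘ (w ↦ u₀ + √θ w)⁻¹` under `v ↦ (v − u₀)/√θ` is `γ`. -/
theorem map_gaussMeasure_reduce {θ : ℝ} (hθ : 0 < θ) (u₀ : V3) :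
    (gaussMeasure u₀ θ).map (fun v : V3 => (Real.sqrt θ)⁻¹ • (v - u₀)) = stdGaussian V3 := by
  have hsv : Measurable fun v : V3 => (Real.sqrt θ)⁻¹ • (v - u₀) := by fun_prop
  have hs : Real.sqrt θ ≠ 0 := (Real.sqrt_pos.2 hθ).ne'
  have hcomp : ((fun v : V3 => (Real.sqrt θ)⁻¹ • (v - u₀)) ∘ fun w : V3 => u₀ + Real.sqrt θ • w) =
      id := by
    funext w
    simp only [Function.comp_apply, add_sub_cancel_left, smul_smul, inv_mul_cancel₀ hs, one_smul,
      id_eq]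
  rw [gaussMeasure, Measure.map_map hsv (measurable_gaussShift u₀ θ), hcomp, Measure.map_id]

/-- **The one-body reduction quasi-preserves Lebesgue measure into `m = vol ⊗ γ`** (`θ > 0`): the image of
Lebesgue measure on `𝕋³ × ℝ³` under `(x, v) ↦ (x, (v − u₀)/√θ)` is absolutely continuous w.r.t.
`vol ⊗ γ` (indeed `vol ⊗ dv ≪ vol ⊗ N(u₀, θ id)`, whose image is exactly `vol ⊗ γ`). -/
theorem quasiMeasurePreserving_oneBodyReduce {θ : ℝ} (hθ : 0 < θ) (u₀ : V3) :
    Measure.QuasiMeasurePreserving (fun y : T3 × V3 => (y.1, (Real.sqrt θ)⁻¹ • (y.2 - u₀)))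
      ((volume : Measure T3).prod (volume : Measure V3)) refMeasure := by
  have hsv : Measurable fun v : V3 => (Real.sqrt θ)⁻¹ • (v - u₀) := by fun_prop
  have hψ := measurable_oneBodyReduce θ u₀
  -- `dv ≪ N(u₀, θ id)` (positive Lebesgue density) is the tree's
  -- `KineticCurrentsWindowLDUniformLocalGibbs.obl_volume_absolutelyContinuous_gaussMeasure`.
  have h1 : (volume : Measure T3).prod (volume : Measure V3) ≪
      (volume : Measure T3).prod (gaussMeasure u₀ θ) :=
    Measure.AbsolutelyContinuous.rfl.prod
      (KineticCurrentsWindowLDUniformLocalGibbs.obl_volume_absolutelyContinuous_gaussMeasure hθ u₀)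
  have h2 : ((volume : Measure T3).prod (gaussMeasure u₀ θ)).map
      (fun y : T3 × V3 => (y.1, (Real.sqrt θ)⁻¹ • (y.2 - u₀))) = refMeasure := by
    have hpm : (fun y : T3 × V3 => (y.1, (Real.sqrt θ)⁻¹ • (y.2 - u₀))) =
        Prod.map id (fun v : V3 => (Real.sqrt θ)⁻¹ • (v - u₀)) := rfl
    rw [hpm, ← Measure.map_prod_map _ _ measurable_id hsv, Measure.map_id,
      map_gaussMeasure_reduce hθ u₀]
    rfl
  exact ⟨hψ, (h1.map hψ).trans h2.absolutelyContinuous⟩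

/-- **`m`-null one-body sets have `G_N`-null one-particle preimages**: for `θ > 0`, every particle `i` and
every `s ⊆ 𝕋³ × ℝ³` with `(vol ⊗ γ)(s) = 0`, `G_N {z | (xᵢ, (vᵢ − u₀)/√θ) ∈ s} = 0` — `G_N ≪ Lebesgue`
(`localGibbsLaw_eq`), the `i`-th coordinate quasi-preserves the product Lebesgue measure
(`Measure.pi_eval_preimage_null`), and `quasiMeasurePreserving_oneBodyReduce`. No sign or size
condition on `a, σ` is needed. -/
theorem gibbs_preimage_reducedCoord_null (σ a : ℝ) {θ : ℝ} (hθ : 0 < θ) (u₀ : V3) (N : ℕ)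
    (Φ : Flow σ N) (i : Fin (N + 1)) {s : Set (T3 × V3)} (hs : refMeasure s = 0) :
    gibbs σ a θ u₀ N Φ (reducedCoord θ u₀ (N + 1) i ⁻¹' s) = 0 := by
  have hG : gibbs σ a θ u₀ N Φ ≪ (volume : Measure (Phase N)) :=
    (localGibbsLaw_eq σ (fun _ => a) (fun _ => u₀) (fun _ => θ) N Φ).absolutelyContinuous.trans
      (withDensity_absolutelyContinuous _ _)
  refine hG ?_
  rw [reducedCoord_eq_comp, Set.preimage_comp]
  -- Lebesgue measure on phase space is the product over particles of `vol ⊗ dv` (definitionally); the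
  -- `SigmaFinite` family is passed explicitly (the default search exceeds `synthInstance.maxSize` under
  -- the binder `∀ i : Fin (N + 1)`).
  exact @Measure.pi_eval_preimage_null (Fin (N + 1)) (fun _ => T3 × V3) _ _
    (fun _ : Fin (N + 1) => (volume : Measure T3).prod (volume : Measure V3))
    (fun _ => inferInstance) i _ ((quasiMeasurePreserving_oneBodyReduce hθ u₀).preimage_null hs)

/-! ### Bounded tensor test functions -/

/-- Pointwise bound `‖φ(x) g(w)‖ ≤ C_φ C_g` for `|φ| ≤ C_φ`, `|g| ≤ C_g`. -/
theorem norm_tensor_le {φ : T3 → ℝ} {g : V3 → ℝ} {Cφ Cg : ℝ} (hCφ : ∀ x, |φ x| ≤ Cφ)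
    (hCg : ∀ w, |g w| ≤ Cg) (x : T3) (w : V3) : ‖φ x * g w‖ ≤ Cφ * Cg := by
  rw [Real.norm_eq_abs, abs_mul]
  exact mul_le_mul (hCφ x) (hCg w) (abs_nonneg _) ((abs_nonneg _).trans (hCφ x))

/-- A bounded measurable tensor test function `φ(x) g(w)` is integrable against every finite measure on
`𝕋³ × ℝ³`. -/
theorem integrable_tensor_of_bound {φ : T3 → ℝ} {g : V3 → ℝ} (hφ : Measurable φ) (hg : Measurable g)
    {Cφ Cg : ℝ} (hCφ : ∀ x, |φ x| ≤ Cφ) (hCg : ∀ w, |g w| ≤ Cg) (μ : Measure (T3 × V3))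
    [IsFiniteMeasure μ] : Integrable (fun y : T3 × V3 => φ y.1 * g y.2) μ :=
  Integrable.of_bound ((hφ.comp measurable_fst).mul (hg.comp measurable_snd)).aestronglyMeasurable
    (Cφ * Cg) (Eventually.of_forall fun y => norm_tensor_le hCφ hCg y.1 y.2)

/-! ### The registered stub -/

/-- **Stub `stub_oneBodyMarginal` (S2) — the reduced one-body law and the gain identity.** In the crux
frame (`θ > 0`, `ν` a probability law with `ν ≪ G_N`), for every time `t`: the reduced one-body law `f_t`
of `ν` is a probability law (`isProbabilityMeasure_oneBodyLaw`), `f_t ≪ vol ⊗ γ` (invariance of `G_N`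
under `Φ_t`, `Theorems.measurePreserving_flow_localGibbsLaw_const`, and
`gibbs_preimage_reducedCoord_null`), and for bounded measurable `φ, g`,
`E_ν[F∘Φ_t] = (N+1) ∫ φ(x) g(w) df_t(x, w)` (change of variables under `Measure.map`, particle by
particle). -/
theorem stub_oneBodyMarginal : OneBodyMarginal := by
  intro σ a θ u₀ N Φ ν hν hθ hνG t
  have hmeas : ∀ i : Fin (N + 1),
      Measurable fun z : Phase N => reducedCoord θ u₀ (N + 1) i (Φ.flow t z) := fun i =>
    (measurable_reducedCoord θ u₀ _ i).comp (Φ.measurable_flow t)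
  refine ⟨isProbabilityMeasure_oneBodyLaw N.add_one_ne_zero θ u₀ Φ ν t, ?_, ?_⟩
  · -- absolute continuity w.r.t. `m = vol ⊗ γ`
    refine Measure.AbsolutelyContinuous.mk fun s hs h0 => ?_
    have hi : ∀ i : Fin (N + 1),
        (ν.map fun z => reducedCoord θ u₀ (N + 1) i (Φ.flow t z)) s = 0 := fun i => by
      rw [Measure.map_apply (hmeas i) hs]
      refine hνG ?_
      exact ((measurePreserving_flow_localGibbsLaw_const σ a θ u₀ N Φ t).measure_preimage
        (measurable_reducedCoord θ u₀ _ i hs).nullMeasurableSet).trans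
          (gibbs_preimage_reducedCoord_null σ a hθ u₀ N Φ i h0)
    simp only [oneBodyLaw, Measure.smul_apply, Measure.coe_finsetSum, Finset.sum_apply, hi,
      Finset.sum_const_zero, smul_zero]
  · -- the gain identity
    rintro φ g hφ hg ⟨Cφ, hCφ⟩ ⟨Cg, hCg⟩
    have hF : Measurable fun y : T3 × V3 => φ y.1 * g y.2 :=
      (hφ.comp measurable_fst).mul (hg.comp measurable_snd)
    -- change of variables, particle by particle
    have hterm : ∀ i : Fin (N + 1),
        ∫ z, φ (Φ.flow t z i).1 * g ((Real.sqrt θ)⁻¹ • ((Φ.flow t z i).2 - u₀)) ∂ν =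
          ∫ y, φ y.1 * g y.2 ∂(ν.map fun z => reducedCoord θ u₀ (N + 1) i (Φ.flow t z)) :=
      fun i => by
      rw [integral_map (hmeas i).aemeasurable hF.aestronglyMeasurable]
      rfl
    have hint : ∀ i : Fin (N + 1), Integrable
        (fun z : Phase N => φ (Φ.flow t z i).1 * g ((Real.sqrt θ)⁻¹ • ((Φ.flow t z i).2 - u₀))) ν :=
      fun i => Integrable.of_bound (hF.comp (hmeas i)).aestronglyMeasurable (Cφ * Cg)
        (Eventually.of_forall fun z => norm_tensor_le hCφ hCg _ _)
    have hL : ∫ z, fluxObs θ u₀ φ g N (Φ.flow t z) ∂ν =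
        ∑ i : Fin (N + 1), ∫ y, φ y.1 * g y.2
          ∂(ν.map fun z => reducedCoord θ u₀ (N + 1) i (Φ.flow t z)) := by
      rw [← Finset.sum_congr rfl fun i _ => hterm i, ← integral_finsetSum _ fun i _ => hint i]
    have hR : ∫ y, φ y.1 * g y.2 ∂(oneBodyLaw θ u₀ Φ ν t) =
        ((N + 1 : ℕ) : ℝ)⁻¹ * ∑ i : Fin (N + 1), ∫ y, φ y.1 * g y.2
          ∂(ν.map fun z => reducedCoord θ u₀ (N + 1) i (Φ.flow t z)) := by
      rw [oneBodyLaw, integral_smul_measure, integral_finsetSum_measure fun i _ =>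
        integrable_tensor_of_bound hφ hg hCφ hCg _, ENNReal.toReal_inv, ENNReal.toReal_natCast,
        smul_eq_mul]
    rw [hL, hR, mul_inv_cancel_left₀ (Nat.cast_ne_zero.2 N.add_one_ne_zero)]

end Summit.AtomisticToContinuum.HydrodynamicLimit.Theorems.HTheorem

end
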